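import Summits.Ventures.CertifiedManyBodySolver.Downfold.BoxesHg1201ELadderUCellsChain
import Summits.Ventures.CertifiedManyBodySolver.Downfold.BoxesHg1201EKinematicCoverTp
import Summits.Ventures.CertifiedManyBodySolver.Downfold.BoxesHg1201EP10KinematicCoverTp
import Summits.Ventures.CertifiedManyBodySolver.Observables.StiffnessApexTransportCurtainTargetSlot
import HarnessLib

/-!
# The U-direction ladder of Hg-1201, part 15: THE CERTIFIED `U`-PREFIX `[7/2, U_hi]` READ ON THE LADDER — from the two EDGE words (left edge on the prefix,
# bottom at the corner station; OUTER slots only after TP-KINCUT) to the prefix strip word, the prefix slice ceiling, and the rungs it buys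

Venture CertifiedManyBodySolver, cell `pub/hubbard-downfold` (MO-S1 → S2 seam; D-0154 (1)(C) COVERAGE (ii) HgBa₂CuO₄₊δ «Hg-1201»), seat `hubbard-cov-hg1201-unc-1`
(lane U MEMBERS + QUOTIENT; rulings R-ma / R-mb (b) / R-mc (a)(b) / R-me (a)); namespace `Summit.Ventures.CertifiedManyBodySolver.Downfold`. Parts 1–14 of this lane:
`BoxesHg1201ULadder` (p607319) … `BoxesHg1201ELadderUCellsChain` (part 14, p626576).

THE OBJECT. The `U`-direction programme of route `CovHg1201M19b` (stmt-Ventures-26186 «PatchLeftEdge», K1) proceeds FROM THE CORNER UPWARD: PIN-HG-U = the cell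
`[7/2, 5]` (kit j304245), then `[5, 44/5]` / the captain's level-1 cells `[7/2, 17/4] · [17/4, 5] · [5, 7] · [7, 44/5]` (obs STATUS l.2727 (a)); K2 «PatchBottom»
(stmt-Ventures-26187) is ONE bottom cell at the corner station `U_A = 7/2` (PIN-HG-B j305801, now read on the SUB-CELL `s ∈ [−27/50, −53/100]` — captain RULING
«TP-KINCUT» obs l.2793, typed by box-2 g1: `BoxesHg1201EKinematicCoverTp` p628432, `hg1201M19b_innerSlot_orbitMean_ge_negBar` = every target slot `σ ∈ [−53/100, −13/25]`
is state-free at every `n ≤ 183/200`, any source, any `U`). The leaf needs the 2-D word on the strip, which the route's `closes` obtains from BOTH edges through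
`Observables.ObsStiffnessSeqCeilingAt_on_box_of_bottomEdge_and_leftEdge_targetSlot` with `U_max = 44/5`. That theorem is `U_max`-GENERIC: the same two edge words with
the left edge known only on a PREFIX `U′ ∈ [7/2, U_hi]` give the strip word on `U ∈ [7/2, U_hi]` — so THE NATURAL INTERIM OBJECT, the day K2 and the first `U`-cells
are certified but the top cells are not, is the PREFIX SLICE `boxHg1201E_M19b.withEntry U [7/2, U_hi]`, and parts 11/12/14 read it rung by rung. This file types that door:

* §Q1 @0: OUTER-slot edge words (`σ ∈ [−27/50, −53/100]`, what the pinned reads certify) ⇒ full-slot edge words (box-2's inner-slot kinematics) ⇒ the prefix STRIP word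
  `∀ tp ∈ [−27/50, −13/25], ∀ U ∈ [7/2, U_hi], ∀ n ∈ [179/200, 183/200], ObsStiffnessSeqCeilingAt tp U n (5166800/10⁷)` (any real `U_hi ≥ 7/2`).
* §Q2 @0: ⇒ the prefix SLICE CEILING (rational `U_hi`; part 12's `stiffnessBoxCeilingBelow_M19bUcell_of_cornerStrip`), and at `U_hi = 44/5` the leaf (consistency with `closes`,
  stated on the `n`-strip and the outer slots only).
* §Q3 @0: WHAT A CERTIFIED PREFIX BUYS ON THE LADDER: the generic rung reading (member `m` eV on `t_eff ∈ [2m/… ]`, precisely `7t/2 ≤ m ≤ U_hi·t`), the full-`t_eff` reach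
  `U ∈ [21/10, U_hi/2]`, the PREFIX CENSUS (member `m`'s whole row is certified iff `2m ≤ U_hi`: `U_hi = 5` → Jang alone; `U_hi = 7` → SIX = Jang + the 3 straddlers + D20 +
  Nilsson; `U_hi = 44/5` → 15 of 16, all but mRPA@QSGW `5.2`), and BY NAME the prefixes `5` (= PIN-HG-U's cell = BC3 `stub_leftEdge_lowU`; part 11's reading), `17/4`, `7`.
* §Q4 @10 twin for route `CovHg1201M19P10` (27104/27105): edge `t′ = −49/100`, outer slots `σ ∈ [−49/100, −12/25]` (unc-3 g5 scan / box-2 `BoxesHg1201EP10KinematicCoverTp`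
  p628477), corner station `U_A = 3`, strip `n ∈ [43/50, 22/25]`, bar″ `4767609/10⁷`; prefix slice on `boxHg1201E_M19P10`; prefix `5` = part 13's `[3, 5]` reading.

Everything here is PROVED (no `sorry`, no new axiom). HONEST FRAMING: every statement is a one-sided CEILING (CONTROL/CALIBRATION, wording class (xx1)) CONDITIONAL on
edge-word hypotheses — the certified pinned-pair / bundle-WN reads of K1/K2 — that do NOT exist at this writing; which cells are read, in which order, is the captain's /
PEN's instrument, not proposed here; item and stub files of 26186/26187 (box-1) and 27104/27105 (box-2) are untouched and un-restated as items (the edge-word hypotheses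
below are their binder shapes restricted to a `U`-prefix, an `n`-strip and the outer slots); nothing about HgBa₂CuO₄₊δ; no row / hull / bar / word of record is touched;
no `T_c`, phase or `dT_c/dP` sentence; no summit statement is proved by this file.
-/

noncomputable section

namespace Summit.Ventures.CertifiedManyBodySolver.Downfold

open Set NonemptyInterval Filter Topology
open Summit.Ventures.CertifiedManyBodySolver.Observables
open Literature.MathematicalPhysics.QuantumLattice Literature.MathematicalPhysics.QuantumLattice.ThermodynamicLimit
open Literature.Probability.LatticeModels
open Matrix Finset
open scoped BigOperators ComplexOrder

/-! ## §Q1 @0: outer-slot edge words ⇒ full-slot edge words ⇒ the prefix strip word -/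

/-- **LEFT EDGE ON A PREFIX, OUTER SLOTS ⇒ ALL SLOTS.** If the «PatchLeftEdge» word (value `−0.5166800`) holds at the edge states `(−27/50, U′, n)`, `U′ ∈ [7/2, U_hi]`,
`n ∈ [179/200, 183/200]`, for the OUTER target slots `σ ∈ [−27/50, −53/100]`, then it holds for every `σ ∈ [−27/50, −13/25]` (inner half by box-2's TP-KINCUT lemma
`hg1201M19b_innerSlot_orbitMean_ge_negBar`, state-free). [cite: HazraVermaRanderia2019, eqs. (2)-(6)] [cite: LiebLoss1993, §8, Theorem 8.2] -/
theorem hg1201M19b_leftEdgePrefix_of_outerSlots {Uhi : ℝ}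
    (hLo : ∀ n ∈ Set.Icc (179 / 200 : ℝ) (183 / 200), ∀ σ ∈ Set.Icc (-27 / 50 : ℝ) (-53 / 100), ∀ U' ∈ Set.Icc (7 / 2 : ℝ) Uhi,
      ∀ (ω : InfVolFermionState 2) (Ls : ℕ → ℕ) (ψ : ∀ L, Fock (Orb (FermionTorus 2 L))),
      Tendsto Ls atTop atTop →
      (∀ j, IsGroundStateInSector (hubbardTorusTT' (Ls j) 1 (-27 / 50) U') (rectN n (Ls j)) 0 (ψ (Ls j))) →
      (∀ j, star (ψ (Ls j)) ⬝ᵥ ψ (Ls j) = 1) → ω.IsTorusLimitOf ψ Ls →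
      -(5166800 / 10000000 : ℝ) ≤ ((Finset.univ : Finset (DihedralGroup 4)).card : ℝ)⁻¹ * ∑ g ∈ (Finset.univ : Finset (DihedralGroup 4)),
        (ω.expect (d4ShiftSet g 0 (Literature.Probability.LatticeModels.box 2 7))
          (fermionEmbed (PolySite.d4Emb g 0 (Literature.Probability.LatticeModels.box 2 7)) (-oddMomentObsTT σ U' 0))).re) :
    ∀ n ∈ Set.Icc (179 / 200 : ℝ) (183 / 200), ∀ σ ∈ Set.Icc (-27 / 50 : ℝ) (-13 / 25), ∀ U' ∈ Set.Icc (7 / 2 : ℝ) Uhi,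
      ∀ (ω : InfVolFermionState 2) (Ls : ℕ → ℕ) (ψ : ∀ L, Fock (Orb (FermionTorus 2 L))),
      Tendsto Ls atTop atTop →
      (∀ j, IsGroundStateInSector (hubbardTorusTT' (Ls j) 1 (-27 / 50) U') (rectN n (Ls j)) 0 (ψ (Ls j))) →
      (∀ j, star (ψ (Ls j)) ⬝ᵥ ψ (Ls j) = 1) → ω.IsTorusLimitOf ψ Ls →
      -(5166800 / 10000000 : ℝ) ≤ ((Finset.univ : Finset (DihedralGroup 4)).card : ℝ)⁻¹ * ∑ g ∈ (Finset.univ : Finset (DihedralGroup 4)),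
        (ω.expect (d4ShiftSet g 0 (Literature.Probability.LatticeModels.box 2 7))
          (fermionEmbed (PolySite.d4Emb g 0 (Literature.Probability.LatticeModels.box 2 7)) (-oddMomentObsTT σ U' 0))).re := by
  intro n hn σ hσ U' hU' ω Ls ψ hLs hψ h1 hω
  rcases le_or_gt σ (-53 / 100) with hcut | hcut
  · exact hLo n hn σ ⟨hσ.1, hcut⟩ U' hU' ω Ls ψ hLs hψ h1 hω
  · exact hg1201M19b_innerSlot_orbitMean_ge_negBar σ U' (-27 / 50) U' ⟨hcut.le, hσ.2⟩ (by linarith [hn.1]) hn.2 ω Ls ψ hLs hψ h1 hω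

/-- **BOTTOM AT THE CORNER STATION, OUTER SLOTS ⇒ ALL SLOTS.** If the «PatchBottom» word holds at the states `(s, 7/2, n)`, `s ∈ [−27/50, σ]`, `n ∈ [179/200, 183/200]`,
for the OUTER slots `σ ∈ [−27/50, −53/100]` (sources then inside the SUB-CELL `[−27/50, −53/100]` — the PIN-HG-B read of record), then it holds for every
`σ ∈ [−27/50, −13/25]` and every source `s ∈ [−27/50, σ]`. [cite: HazraVermaRanderia2019, eqs. (2)-(6)] [cite: LiebLoss1993, §8, Theorem 8.2] -/
theorem hg1201M19b_bottomStrip_of_outerSlots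
    (hBo : ∀ n ∈ Set.Icc (179 / 200 : ℝ) (183 / 200), ∀ σ ∈ Set.Icc (-27 / 50 : ℝ) (-53 / 100), ∀ s ∈ Set.Icc (-27 / 50 : ℝ) σ,
      ∀ (ω : InfVolFermionState 2) (Ls : ℕ → ℕ) (ψ : ∀ L, Fock (Orb (FermionTorus 2 L))),
      Tendsto Ls atTop atTop →
      (∀ j, IsGroundStateInSector (hubbardTorusTT' (Ls j) 1 s (7 / 2)) (rectN n (Ls j)) 0 (ψ (Ls j))) →
      (∀ j, star (ψ (Ls j)) ⬝ᵥ ψ (Ls j) = 1) → ω.IsTorusLimitOf ψ Ls →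
      -(5166800 / 10000000 : ℝ) ≤ ((Finset.univ : Finset (DihedralGroup 4)).card : ℝ)⁻¹ * ∑ g ∈ (Finset.univ : Finset (DihedralGroup 4)),
        (ω.expect (d4ShiftSet g 0 (Literature.Probability.LatticeModels.box 2 7))
          (fermionEmbed (PolySite.d4Emb g 0 (Literature.Probability.LatticeModels.box 2 7)) (-oddMomentObsTT σ (7 / 2) 0))).re) :
    ∀ n ∈ Set.Icc (179 / 200 : ℝ) (183 / 200), ∀ σ ∈ Set.Icc (-27 / 50 : ℝ) (-13 / 25), ∀ s ∈ Set.Icc (-27 / 50 : ℝ) σ,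
      ∀ (ω : InfVolFermionState 2) (Ls : ℕ → ℕ) (ψ : ∀ L, Fock (Orb (FermionTorus 2 L))),
      Tendsto Ls atTop atTop →
      (∀ j, IsGroundStateInSector (hubbardTorusTT' (Ls j) 1 s (7 / 2)) (rectN n (Ls j)) 0 (ψ (Ls j))) →
      (∀ j, star (ψ (Ls j)) ⬝ᵥ ψ (Ls j) = 1) → ω.IsTorusLimitOf ψ Ls →
      -(5166800 / 10000000 : ℝ) ≤ ((Finset.univ : Finset (DihedralGroup 4)).card : ℝ)⁻¹ * ∑ g ∈ (Finset.univ : Finset (DihedralGroup 4)),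
        (ω.expect (d4ShiftSet g 0 (Literature.Probability.LatticeModels.box 2 7))
          (fermionEmbed (PolySite.d4Emb g 0 (Literature.Probability.LatticeModels.box 2 7)) (-oddMomentObsTT σ (7 / 2) 0))).re := by
  intro n hn σ hσ s hs ω Ls ψ hLs hψ h1 hω
  rcases le_or_gt σ (-53 / 100) with hcut | hcut
  · exact hBo n hn σ ⟨hσ.1, hcut⟩ s hs ω Ls ψ hLs hψ h1 hω
  · exact hg1201M19b_innerSlot_orbitMean_ge_negBar σ (7 / 2) s (7 / 2) ⟨hcut.le, hσ.2⟩ (by linarith [hn.1]) hn.2 ω Ls ψ hLs hψ h1 hω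

/-- **THE PREFIX STRIP WORD FROM THE TWO EDGE WORDS** (all slots; any real `U_hi ≥ 7/2`): the 2-D target-slot curtain of the route's `closes`, run with `U_max = U_hi`.
CONDITIONAL on both edge words. [cite: KomaTasaki1994, §1] [cite: ScalapinoWhiteZhang1993, §II] -/
theorem hg1201M19b_prefixStrip_of_edgeWords {Uhi : ℝ} (hUhi : 7 / 2 ≤ Uhi)
    (hL : ∀ n ∈ Set.Icc (179 / 200 : ℝ) (183 / 200), ∀ σ ∈ Set.Icc (-27 / 50 : ℝ) (-13 / 25), ∀ U' ∈ Set.Icc (7 / 2 : ℝ) Uhi,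
      ∀ (ω : InfVolFermionState 2) (Ls : ℕ → ℕ) (ψ : ∀ L, Fock (Orb (FermionTorus 2 L))),
      Tendsto Ls atTop atTop →
      (∀ j, IsGroundStateInSector (hubbardTorusTT' (Ls j) 1 (-27 / 50) U') (rectN n (Ls j)) 0 (ψ (Ls j))) →
      (∀ j, star (ψ (Ls j)) ⬝ᵥ ψ (Ls j) = 1) → ω.IsTorusLimitOf ψ Ls →
      -(5166800 / 10000000 : ℝ) ≤ ((Finset.univ : Finset (DihedralGroup 4)).card : ℝ)⁻¹ * ∑ g ∈ (Finset.univ : Finset (DihedralGroup 4)),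
        (ω.expect (d4ShiftSet g 0 (Literature.Probability.LatticeModels.box 2 7))
          (fermionEmbed (PolySite.d4Emb g 0 (Literature.Probability.LatticeModels.box 2 7)) (-oddMomentObsTT σ U' 0))).re)
    (hB : ∀ n ∈ Set.Icc (179 / 200 : ℝ) (183 / 200), ∀ σ ∈ Set.Icc (-27 / 50 : ℝ) (-13 / 25), ∀ s ∈ Set.Icc (-27 / 50 : ℝ) σ,
      ∀ (ω : InfVolFermionState 2) (Ls : ℕ → ℕ) (ψ : ∀ L, Fock (Orb (FermionTorus 2 L))),
      Tendsto Ls atTop atTop →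
      (∀ j, IsGroundStateInSector (hubbardTorusTT' (Ls j) 1 s (7 / 2)) (rectN n (Ls j)) 0 (ψ (Ls j))) →
      (∀ j, star (ψ (Ls j)) ⬝ᵥ ψ (Ls j) = 1) → ω.IsTorusLimitOf ψ Ls →
      -(5166800 / 10000000 : ℝ) ≤ ((Finset.univ : Finset (DihedralGroup 4)).card : ℝ)⁻¹ * ∑ g ∈ (Finset.univ : Finset (DihedralGroup 4)),
        (ω.expect (d4ShiftSet g 0 (Literature.Probability.LatticeModels.box 2 7))
          (fermionEmbed (PolySite.d4Emb g 0 (Literature.Probability.LatticeModels.box 2 7)) (-oddMomentObsTT σ (7 / 2) 0))).re) :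
    ∀ tp ∈ Icc (-27 / 50 : ℝ) (-13 / 25), ∀ U ∈ Icc (7 / 2 : ℝ) Uhi, ∀ n ∈ Icc (179 / 200 : ℝ) (183 / 200),
      ObsStiffnessSeqCeilingAt tp U n (5166800 / 10000000) := by
  intro tp htp U hU n hn
  exact ObsStiffnessSeqCeilingAt_on_box_of_bottomEdge_and_leftEdge_targetSlot (p := -27 / 50) (q := -13 / 25) (UA := 7 / 2)
    (Umax := Uhi) (n := n) (by norm_num) hUhi (by norm_num) (by linarith [hn.1]) (by linarith [hn.2])
    (fun _ _ => -(5166800 / 10000000 : ℝ)) (fun _ _ => -(5166800 / 10000000 : ℝ)) (5166800 / 10000000)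
    (fun σ hσ s hs => hB n hn σ hσ s hs) (fun σ _ s _ => by norm_num) (fun σ hσ U' hU' => hL n hn σ hσ U' hU')
    (fun σ _ U' _ => by norm_num) tp htp U hU

/-- **THE PREFIX STRIP WORD FROM THE OUTER-SLOT EDGE WORDS** (what the pinned reads certify after TP-KINCUT: left edge on `[7/2, U_hi]`, bottom sub-cell at `U_A = 7/2`,
both for `σ ∈ [−27/50, −53/100]` only). CONDITIONAL. [cite: KomaTasaki1994, §1] [cite: ScalapinoWhiteZhang1993, §II] -/
theorem hg1201M19b_prefixStrip_of_outerEdgeWords {Uhi : ℝ} (hUhi : 7 / 2 ≤ Uhi)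
    (hLo : ∀ n ∈ Set.Icc (179 / 200 : ℝ) (183 / 200), ∀ σ ∈ Set.Icc (-27 / 50 : ℝ) (-53 / 100), ∀ U' ∈ Set.Icc (7 / 2 : ℝ) Uhi,
      ∀ (ω : InfVolFermionState 2) (Ls : ℕ → ℕ) (ψ : ∀ L, Fock (Orb (FermionTorus 2 L))),
      Tendsto Ls atTop atTop →
      (∀ j, IsGroundStateInSector (hubbardTorusTT' (Ls j) 1 (-27 / 50) U') (rectN n (Ls j)) 0 (ψ (Ls j))) →
      (∀ j, star (ψ (Ls j)) ⬝ᵥ ψ (Ls j) = 1) → ω.IsTorusLimitOf ψ Ls →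
      -(5166800 / 10000000 : ℝ) ≤ ((Finset.univ : Finset (DihedralGroup 4)).card : ℝ)⁻¹ * ∑ g ∈ (Finset.univ : Finset (DihedralGroup 4)),
        (ω.expect (d4ShiftSet g 0 (Literature.Probability.LatticeModels.box 2 7))
          (fermionEmbed (PolySite.d4Emb g 0 (Literature.Probability.LatticeModels.box 2 7)) (-oddMomentObsTT σ U' 0))).re)
    (hBo : ∀ n ∈ Set.Icc (179 / 200 : ℝ) (183 / 200), ∀ σ ∈ Set.Icc (-27 / 50 : ℝ) (-53 / 100), ∀ s ∈ Set.Icc (-27 / 50 : ℝ) σ,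
      ∀ (ω : InfVolFermionState 2) (Ls : ℕ → ℕ) (ψ : ∀ L, Fock (Orb (FermionTorus 2 L))),
      Tendsto Ls atTop atTop →
      (∀ j, IsGroundStateInSector (hubbardTorusTT' (Ls j) 1 s (7 / 2)) (rectN n (Ls j)) 0 (ψ (Ls j))) →
      (∀ j, star (ψ (Ls j)) ⬝ᵥ ψ (Ls j) = 1) → ω.IsTorusLimitOf ψ Ls →
      -(5166800 / 10000000 : ℝ) ≤ ((Finset.univ : Finset (DihedralGroup 4)).card : ℝ)⁻¹ * ∑ g ∈ (Finset.univ : Finset (DihedralGroup 4)),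
        (ω.expect (d4ShiftSet g 0 (Literature.Probability.LatticeModels.box 2 7))
          (fermionEmbed (PolySite.d4Emb g 0 (Literature.Probability.LatticeModels.box 2 7)) (-oddMomentObsTT σ (7 / 2) 0))).re) :
    ∀ tp ∈ Icc (-27 / 50 : ℝ) (-13 / 25), ∀ U ∈ Icc (7 / 2 : ℝ) Uhi, ∀ n ∈ Icc (179 / 200 : ℝ) (183 / 200),
      ObsStiffnessSeqCeilingAt tp U n (5166800 / 10000000) :=
  hg1201M19b_prefixStrip_of_edgeWords hUhi (hg1201M19b_leftEdgePrefix_of_outerSlots hLo) (hg1201M19b_bottomStrip_of_outerSlots hBo)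

/-! ## §Q2 @0: the prefix slice ceiling; the leaf at `U_hi = 44/5` -/

/-- **THE PREFIX SLICE CEILING**: the outer-slot edge words on the prefix `[7/2, U_hi]` (rational `U_hi ≥ 7/2`) give `StiffnessBoxCeilingBelow (boxHg1201E_M19b.withEntry U
[7/2, U_hi]) (5166800/10⁷)` (§Q1 + part 12's `stiffnessBoxCeilingBelow_M19bUcell_of_cornerStrip`). The interim object of record-to-be when K2 and the first `U`-cells are
certified. CONDITIONAL. [cite: ScalapinoWhiteZhang1993, §II] -/
theorem stiffnessBoxCeilingBelow_M19bPrefix_of_outerEdgeWords {Uhi : ℚ} (hUhi : (7 / 2 : ℚ) ≤ Uhi)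
    (hLo : ∀ n ∈ Set.Icc (179 / 200 : ℝ) (183 / 200), ∀ σ ∈ Set.Icc (-27 / 50 : ℝ) (-53 / 100), ∀ U' ∈ Set.Icc (7 / 2 : ℝ) (Uhi : ℝ),
      ∀ (ω : InfVolFermionState 2) (Ls : ℕ → ℕ) (ψ : ∀ L, Fock (Orb (FermionTorus 2 L))),
      Tendsto Ls atTop atTop →
      (∀ j, IsGroundStateInSector (hubbardTorusTT' (Ls j) 1 (-27 / 50) U') (rectN n (Ls j)) 0 (ψ (Ls j))) →
      (∀ j, star (ψ (Ls j)) ⬝ᵥ ψ (Ls j) = 1) → ω.IsTorusLimitOf ψ Ls →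
      -(5166800 / 10000000 : ℝ) ≤ ((Finset.univ : Finset (DihedralGroup 4)).card : ℝ)⁻¹ * ∑ g ∈ (Finset.univ : Finset (DihedralGroup 4)),
        (ω.expect (d4ShiftSet g 0 (Literature.Probability.LatticeModels.box 2 7))
          (fermionEmbed (PolySite.d4Emb g 0 (Literature.Probability.LatticeModels.box 2 7)) (-oddMomentObsTT σ U' 0))).re)
    (hBo : ∀ n ∈ Set.Icc (179 / 200 : ℝ) (183 / 200), ∀ σ ∈ Set.Icc (-27 / 50 : ℝ) (-53 / 100), ∀ s ∈ Set.Icc (-27 / 50 : ℝ) σ,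
      ∀ (ω : InfVolFermionState 2) (Ls : ℕ → ℕ) (ψ : ∀ L, Fock (Orb (FermionTorus 2 L))),
      Tendsto Ls atTop atTop →
      (∀ j, IsGroundStateInSector (hubbardTorusTT' (Ls j) 1 s (7 / 2)) (rectN n (Ls j)) 0 (ψ (Ls j))) →
      (∀ j, star (ψ (Ls j)) ⬝ᵥ ψ (Ls j) = 1) → ω.IsTorusLimitOf ψ Ls →
      -(5166800 / 10000000 : ℝ) ≤ ((Finset.univ : Finset (DihedralGroup 4)).card : ℝ)⁻¹ * ∑ g ∈ (Finset.univ : Finset (DihedralGroup 4)),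
        (ω.expect (d4ShiftSet g 0 (Literature.Probability.LatticeModels.box 2 7))
          (fermionEmbed (PolySite.d4Emb g 0 (Literature.Probability.LatticeModels.box 2 7)) (-oddMomentObsTT σ (7 / 2) 0))).re) :
    StiffnessBoxCeilingBelow (boxHg1201E_M19b.withEntry .UOverT (Entry.ofEnds (7 / 2) Uhi hUhi .screening)) (5166800 / 10000000) := by
  have hU' : (7 / 2 : ℝ) ≤ (Uhi : ℝ) := by
    have := (Rat.cast_le (K := ℝ)).mpr hUhi
    push_cast at this
    exact this
  have h := hg1201M19b_prefixStrip_of_outerEdgeWords hU' hLo hBo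
  refine stiffnessBoxCeilingBelow_M19bUcell_of_cornerStrip hUhi le_rfl fun tp htp U hU n hn => h tp htp U ⟨?_, hU.2⟩ n hn
  have h1 := hU.1
  push_cast at h1
  exact h1

/-- **AT `U_hi = 44/5` THE PREFIX IS THE BOX: the leaf «MOS2-hg1201-M19b» from the outer-slot edge words on the `n`-strip** (K1 on `σ ∈ [−27/50, −53/100] × U′ ∈ [7/2, 44/5]
× n ∈ [179/200, 183/200]` and K2 on the sub-cell — the certificate content of 26186/26187 after the n- and t′-cuts, cf. unc-2's `R″` and box-2's `…_of_outerStrip`).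
CONDITIONAL. [cite: KomaTasaki1994, §1] [cite: ScalapinoWhiteZhang1993, §II] -/
theorem Hg1201M19b_StiffnessBoxCeiling_of_outerEdgeWords
    (hLo : ∀ n ∈ Set.Icc (179 / 200 : ℝ) (183 / 200), ∀ σ ∈ Set.Icc (-27 / 50 : ℝ) (-53 / 100), ∀ U' ∈ Set.Icc (7 / 2 : ℝ) (44 / 5),
      ∀ (ω : InfVolFermionState 2) (Ls : ℕ → ℕ) (ψ : ∀ L, Fock (Orb (FermionTorus 2 L))),
      Tendsto Ls atTop atTop →
      (∀ j, IsGroundStateInSector (hubbardTorusTT' (Ls j) 1 (-27 / 50) U') (rectN n (Ls j)) 0 (ψ (Ls j))) →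
      (∀ j, star (ψ (Ls j)) ⬝ᵥ ψ (Ls j) = 1) → ω.IsTorusLimitOf ψ Ls →
      -(5166800 / 10000000 : ℝ) ≤ ((Finset.univ : Finset (DihedralGroup 4)).card : ℝ)⁻¹ * ∑ g ∈ (Finset.univ : Finset (DihedralGroup 4)),
        (ω.expect (d4ShiftSet g 0 (Literature.Probability.LatticeModels.box 2 7))
          (fermionEmbed (PolySite.d4Emb g 0 (Literature.Probability.LatticeModels.box 2 7)) (-oddMomentObsTT σ U' 0))).re)
    (hBo : ∀ n ∈ Set.Icc (179 / 200 : ℝ) (183 / 200), ∀ σ ∈ Set.Icc (-27 / 50 : ℝ) (-53 / 100), ∀ s ∈ Set.Icc (-27 / 50 : ℝ) σ,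
      ∀ (ω : InfVolFermionState 2) (Ls : ℕ → ℕ) (ψ : ∀ L, Fock (Orb (FermionTorus 2 L))),
      Tendsto Ls atTop atTop →
      (∀ j, IsGroundStateInSector (hubbardTorusTT' (Ls j) 1 s (7 / 2)) (rectN n (Ls j)) 0 (ψ (Ls j))) →
      (∀ j, star (ψ (Ls j)) ⬝ᵥ ψ (Ls j) = 1) → ω.IsTorusLimitOf ψ Ls →
      -(5166800 / 10000000 : ℝ) ≤ ((Finset.univ : Finset (DihedralGroup 4)).card : ℝ)⁻¹ * ∑ g ∈ (Finset.univ : Finset (DihedralGroup 4)),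
        (ω.expect (d4ShiftSet g 0 (Literature.Probability.LatticeModels.box 2 7))
          (fermionEmbed (PolySite.d4Emb g 0 (Literature.Probability.LatticeModels.box 2 7)) (-oddMomentObsTT σ (7 / 2) 0))).re) :
    Hg1201M19b_StiffnessBoxCeiling :=
  Hg1201M19b_StiffnessBoxCeiling_of_cornerStrip le_rfl (hg1201M19b_prefixStrip_of_outerEdgeWords (by norm_num) hLo hBo)

/-! ## §Q3 @0: what a certified prefix buys on the ladder (CONDITIONAL on the prefix slice ceiling of §Q2, however obtained) -/

/-- **THE PREFIX RUNG READING**: a ceiling on the prefix slice `[7/2, U_hi]` certifies ONE `c ≤ bar` at every `(U eV, t_eff)` with `7t/2 ≤ U ≤ U_hi·t` — member `m` on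
`t_eff ∈ [m/U_hi, 2m/7] ∩ [1/2, 3/5]` — and at every `U ∈ [21/10, U_hi/2]` for EVERY `t_eff` (part 12's generic readings at `lo = 7/2`). CONDITIONAL.
[cite: ScalapinoWhiteZhang1993, §II] -/
theorem hg1201E_prefix_rungs_of_ceiling {Uhi : ℚ} (hUhi : (7 / 2 : ℚ) ≤ Uhi) {bar : ℚ}
    (h : StiffnessBoxCeilingBelow (boxHg1201E_M19b.withEntry .UOverT (Entry.ofEnds (7 / 2) Uhi hUhi .screening)) bar) :
    ∃ c : ℚ, c ≤ bar ∧
      (∀ U t tp n : ℝ, ((7 / 2 : ℝ) * t ≤ U ∧ U ≤ Uhi * t) → hg1201E_M19b_t.Mem t → hg1201E_M19b_tp.Mem tp → hg1201E_M19b_n.Mem n →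
        ObsStiffnessSeqCeilingAt tp (U / t) n c) ∧
      (∀ U t tp n : ℝ, ((21 / 10 : ℝ) ≤ U ∧ U ≤ Uhi / 2) → hg1201E_M19b_t.Mem t → hg1201E_M19b_tp.Mem tp → hg1201E_M19b_n.Mem n →
        ObsStiffnessSeqCeilingAt tp (U / t) n c) := by
  obtain ⟨c, hc, hW⟩ := hg1201E_Ucell_rungs_of_ceiling hUhi h
  refine ⟨c, hc, fun U t tp n hU ht htp hn => hW U t tp n ?_ ht htp hn, fun U t tp n hU ht htp hn => hW U t tp n ?_ ht htp hn⟩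
  · have ht' := (Entry.mem_ofEnds_iff _ _ _ _ _).1 ht; push_cast at ht'
    have ht0 : (0 : ℝ) < t := by linarith [ht'.1]
    exact ⟨by push_cast; rw [le_div_iff₀ ht0]; linarith [hU.1], by rw [div_le_iff₀ ht0]; linarith [hU.2]⟩
  · have ht' := (Entry.mem_ofEnds_iff _ _ _ _ _).1 ht; push_cast at ht'
    have hq := (hg1201E_Ucell_Ureach_iff (lo := 7 / 2) (hi := Uhi) (by norm_num) (U := U)).2 ⟨by push_cast; linarith [hU.1], hU.2⟩ t ht'
    exact ⟨by push_cast at hq ⊢; exact hq.1, hq.2⟩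

/-- **THE PREFIX CENSUS** (numbers only; the 16 members of parts 1/5): member `m`'s WHOLE `t_eff` row `[5m/3, 2m]` lies in the prefix `[7/2, U_hi]` iff `2m ≤ U_hi` (the lower
end `5m/3 ≥ 7/2` holds for every member, `m ≥ 2.15 > 2.1`). `U_hi = 5`: Jang `2.15` alone; `U_hi = 7`: the SIX `{2.15, 2.865, 2.9462, 2.98, 3.335, 3.42}` = Jang ∪ part 11's
straddlers ∪ part 12's `[5, 7]` pair; `U_hi = 44/5`: all but mRPA@QSGW `5.2` (15 of 16). [folklore] -/
theorem hg1201E_prefix_census :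
    (∀ m ∈ hg1201U_members, (21 / 10 : ℚ) < m) ∧
    (∀ m ∈ hg1201U_members, 2 * m ≤ 5 ↔ m = hg1201U_jang2016) ∧
    (∀ m ∈ hg1201U_members, 2 * m ≤ 7 ↔ (m = hg1201U_jang2016 ∨ m ∈ hg1201U_bank5_straddle ∨ m ∈ hg1201U_level1_cell57)) ∧
    (∀ m ∈ hg1201U_members, 2 * m ≤ 44 / 5 ↔ m ≠ hg1201U_sakakibara2017_mRPA_QSGW) ∧
    1 + hg1201U_bank5_straddle.length + hg1201U_level1_cell57.length = 6 := by
  refine ⟨?_, ?_, ?_, ?_, by decide⟩ <;>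
    simp only [hg1201U_members, hg1201U_bank5_straddle, hg1201U_level1_cell57, List.mem_cons, List.mem_nil_iff, or_false] <;>
    rintro m (rfl | rfl | rfl | rfl | rfl | rfl | rfl | rfl | rfl | rfl | rfl | rfl | rfl | rfl | rfl | rfl) <;>
    norm_num [hg1201U_jang2016, hg1201U_inhouseW26, hg1201U_teranishi2018, hg1201U_vucicevic2026, hg1201U_inhouseD20, hg1201U_nilsson2019,
      hg1201U_sakakibara2017_cRPA_QSGW, hg1201U_sakakibara2017_mRPA_LDA, hg1201U_sakakibara2017_mRPA_QSGW, hg1201U_hirayama2019_LRFB,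
      hg1201U_moree2022_d01, hg1201U_moree2022_d00, hg1201U_hirayama2018_cGW, hg1201U_moreeArita2024_d00, hg1201U_moreeArita2024_d01,
      hg1201U_moreeArita2024_d02]

/-- **PREFIX `5` BY NAME = PIN-HG-U's cell = BC3 `stub_leftEdge_lowU`'s slab**: the `[7/2, 5]` slice of this file IS unc-2's `boxHg1201E_M19b_slabLo`, so part 11's reading
applies verbatim: every `U ∈ [21/10, 5/2]` eV (the Jang band) at EVERY `t_eff`, and each straddler `m ∈ {2.865, 2.9462, 2.98}` on `t_eff ∈ [m/5, 3/5]`. CONDITIONAL on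
the outer-slot edge words on the prefix `5`. [cite: ScalapinoWhiteZhang1993, §II] -/
theorem hg1201E_prefix5_rungs_of_outerEdgeWords
    (hLo : ∀ n ∈ Set.Icc (179 / 200 : ℝ) (183 / 200), ∀ σ ∈ Set.Icc (-27 / 50 : ℝ) (-53 / 100), ∀ U' ∈ Set.Icc (7 / 2 : ℝ) ((5 : ℚ) : ℝ),
      ∀ (ω : InfVolFermionState 2) (Ls : ℕ → ℕ) (ψ : ∀ L, Fock (Orb (FermionTorus 2 L))),
      Tendsto Ls atTop atTop →
      (∀ j, IsGroundStateInSector (hubbardTorusTT' (Ls j) 1 (-27 / 50) U') (rectN n (Ls j)) 0 (ψ (Ls j))) →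
      (∀ j, star (ψ (Ls j)) ⬝ᵥ ψ (Ls j) = 1) → ω.IsTorusLimitOf ψ Ls →
      -(5166800 / 10000000 : ℝ) ≤ ((Finset.univ : Finset (DihedralGroup 4)).card : ℝ)⁻¹ * ∑ g ∈ (Finset.univ : Finset (DihedralGroup 4)),
        (ω.expect (d4ShiftSet g 0 (Literature.Probability.LatticeModels.box 2 7))
          (fermionEmbed (PolySite.d4Emb g 0 (Literature.Probability.LatticeModels.box 2 7)) (-oddMomentObsTT σ U' 0))).re)
    (hBo : ∀ n ∈ Set.Icc (179 / 200 : ℝ) (183 / 200), ∀ σ ∈ Set.Icc (-27 / 50 : ℝ) (-53 / 100), ∀ s ∈ Set.Icc (-27 / 50 : ℝ) σ,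
      ∀ (ω : InfVolFermionState 2) (Ls : ℕ → ℕ) (ψ : ∀ L, Fock (Orb (FermionTorus 2 L))),
      Tendsto Ls atTop atTop →
      (∀ j, IsGroundStateInSector (hubbardTorusTT' (Ls j) 1 s (7 / 2)) (rectN n (Ls j)) 0 (ψ (Ls j))) →
      (∀ j, star (ψ (Ls j)) ⬝ᵥ ψ (Ls j) = 1) → ω.IsTorusLimitOf ψ Ls →
      -(5166800 / 10000000 : ℝ) ≤ ((Finset.univ : Finset (DihedralGroup 4)).card : ℝ)⁻¹ * ∑ g ∈ (Finset.univ : Finset (DihedralGroup 4)),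
        (ω.expect (d4ShiftSet g 0 (Literature.Probability.LatticeModels.box 2 7))
          (fermionEmbed (PolySite.d4Emb g 0 (Literature.Probability.LatticeModels.box 2 7)) (-oddMomentObsTT σ (7 / 2) 0))).re) :
    StiffnessBoxCeilingBelow boxHg1201E_M19b_slabLo (5166800 / 10000000) ∧
    ∃ c : ℚ, c ≤ 5166800 / 10000000 ∧
      (∀ U t tp n : ℝ, ((21 / 10 : ℝ) ≤ U ∧ U ≤ 5 / 2) → hg1201E_M19b_t.Mem t → hg1201E_M19b_tp.Mem tp → hg1201E_M19b_n.Mem n →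
        ObsStiffnessSeqCeilingAt tp (U / t) n c) ∧
      (∀ m ∈ hg1201U_bank5_straddle, ∀ t tp n : ℝ, ((m : ℝ) / 5 ≤ t ∧ t ≤ 3 / 5) → hg1201E_M19b_tp.Mem tp → hg1201E_M19b_n.Mem n →
        ObsStiffnessSeqCeilingAt tp ((m : ℝ) / t) n c) := by
  have h : StiffnessBoxCeilingBelow boxHg1201E_M19b_slabLo (5166800 / 10000000) :=
    stiffnessBoxCeilingBelow_M19bPrefix_of_outerEdgeWords (Uhi := 5) (by norm_num) hLo hBo
  exact ⟨h, hg1201E_slabLo_rungs_of_ceiling h⟩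

/-- **PREFIXES `17/4` AND `7` BY NAME** (the captain's level-1 breakpoints): a ceiling on `[7/2, 17/4]` gives the Jang rung on `t_eff ∈ [43/85, 3/5]` + every `U ∈ [21/10, 17/8]`
(part 12's first low-cell reading — the prefix IS that cell); a ceiling on `[7/2, 7]` gives every `U ∈ [21/10, 7/2]` eV at EVERY `t_eff` (the SIX of the census) + each of
the eight cut-at-7 members `m` on `t_eff ∈ [m/7, 3/5]`. CONDITIONAL on the respective prefix ceilings. [cite: ScalapinoWhiteZhang1993, §II] -/
theorem hg1201E_prefix7_rungs_of_ceiling {bar : ℚ}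
    (h : StiffnessBoxCeilingBelow (boxHg1201E_M19b.withEntry .UOverT (Entry.ofEnds (7 / 2) 7 (by norm_num) .screening)) bar) :
    ∃ c : ℚ, c ≤ bar ∧
      (∀ U t tp n : ℝ, ((21 / 10 : ℝ) ≤ U ∧ U ≤ 7 / 2) → hg1201E_M19b_t.Mem t → hg1201E_M19b_tp.Mem tp → hg1201E_M19b_n.Mem n →
        ObsStiffnessSeqCeilingAt tp (U / t) n c) ∧
      (∀ m ∈ hg1201U_level1_cut7, ∀ t tp n : ℝ, ((m : ℝ) / 7 ≤ t ∧ t ≤ 3 / 5) → hg1201E_M19b_tp.Mem tp → hg1201E_M19b_n.Mem n →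
        ObsStiffnessSeqCeilingAt tp ((m : ℝ) / t) n c) := by
  obtain ⟨c, hc, hW, hfull⟩ := hg1201E_prefix_rungs_of_ceiling (Uhi := 7) (by norm_num) h
  refine ⟨c, hc, fun U t tp n hU ht htp hn => hfull U t tp n ⟨hU.1, by push_cast; linarith [hU.2]⟩ ht htp hn, fun m hm t tp n ht htp hn => ?_⟩
  have hlo : ((7 / 2 : ℚ) : ℝ) < (m : ℝ) := (Rat.cast_lt (K := ℝ)).mpr (hg1201U_level1_cut7_window hm).1.1
  push_cast at hlo
  have ht1 : (1 / 2 : ℝ) ≤ t := by linarith [ht.1]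
  have htE : hg1201E_M19b_t.Mem t := (Entry.mem_ofEnds_iff _ _ _ _ _).2 (by push_cast; exact ⟨ht1, ht.2⟩)
  refine hW _ t tp n ⟨?_, ?_⟩ htE htp hn
  · linarith [ht.2]
  · push_cast; have := ht.1; rw [div_le_iff₀ (by norm_num : (0 : ℝ) < 7)] at this; linarith

/-! ## §Q4 @10 twin (route `CovHg1201M19P10`: edge `t′ = −49/100`, outer slots `[−49/100, −12/25]`, corner station `U_A = 3`, strip `n ∈ [43/50, 22/25]`, bar″ `4767609/10⁷`) -/

/-- **@10 PREFIX STRIP WORD FROM THE OUTER-SLOT EDGE WORDS** (left edge on `U′ ∈ [3, U_hi]`, bottom at `U_A = 3` with sources in the sub-cell `[−49/100, σ]`, both for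
`σ ∈ [−49/100, −12/25]`; inner slots `σ ∈ [−12/25, −47/100]` by `hg1201M19P10_innerSlot_orbitMean_ge_negBar`; then the curtain with `U_max = U_hi`). CONDITIONAL.
[cite: KomaTasaki1994, §1] [cite: ScalapinoWhiteZhang1993, §II] [cite: LiebLoss1993, §8, Theorem 8.2] -/
theorem hg1201M19P10_prefixStrip_of_outerEdgeWords {Uhi : ℝ} (hUhi : 3 ≤ Uhi)
    (hLo : ∀ n ∈ Set.Icc (43 / 50 : ℝ) (22 / 25), ∀ σ ∈ Set.Icc (-49 / 100 : ℝ) (-12 / 25), ∀ U' ∈ Set.Icc (3 : ℝ) Uhi,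
      ∀ (ω : InfVolFermionState 2) (Ls : ℕ → ℕ) (ψ : ∀ L, Fock (Orb (FermionTorus 2 L))),
      Tendsto Ls atTop atTop →
      (∀ j, IsGroundStateInSector (hubbardTorusTT' (Ls j) 1 (-49 / 100) U') (rectN n (Ls j)) 0 (ψ (Ls j))) →
      (∀ j, star (ψ (Ls j)) ⬝ᵥ ψ (Ls j) = 1) → ω.IsTorusLimitOf ψ Ls →
      -(4767609 / 10000000 : ℝ) ≤ ((Finset.univ : Finset (DihedralGroup 4)).card : ℝ)⁻¹ * ∑ g ∈ (Finset.univ : Finset (DihedralGroup 4)),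
        (ω.expect (d4ShiftSet g 0 (Literature.Probability.LatticeModels.box 2 7))
          (fermionEmbed (PolySite.d4Emb g 0 (Literature.Probability.LatticeModels.box 2 7)) (-oddMomentObsTT σ U' 0))).re)
    (hBo : ∀ n ∈ Set.Icc (43 / 50 : ℝ) (22 / 25), ∀ σ ∈ Set.Icc (-49 / 100 : ℝ) (-12 / 25), ∀ s ∈ Set.Icc (-49 / 100 : ℝ) σ,
      ∀ (ω : InfVolFermionState 2) (Ls : ℕ → ℕ) (ψ : ∀ L, Fock (Orb (FermionTorus 2 L))),
      Tendsto Ls atTop atTop →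
      (∀ j, IsGroundStateInSector (hubbardTorusTT' (Ls j) 1 s 3) (rectN n (Ls j)) 0 (ψ (Ls j))) →
      (∀ j, star (ψ (Ls j)) ⬝ᵥ ψ (Ls j) = 1) → ω.IsTorusLimitOf ψ Ls →
      -(4767609 / 10000000 : ℝ) ≤ ((Finset.univ : Finset (DihedralGroup 4)).card : ℝ)⁻¹ * ∑ g ∈ (Finset.univ : Finset (DihedralGroup 4)),
        (ω.expect (d4ShiftSet g 0 (Literature.Probability.LatticeModels.box 2 7))
          (fermionEmbed (PolySite.d4Emb g 0 (Literature.Probability.LatticeModels.box 2 7)) (-oddMomentObsTT σ 3 0))).re) :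
    ∀ tp ∈ Icc (-49 / 100 : ℝ) (-47 / 100), ∀ U ∈ Icc (3 : ℝ) Uhi, ∀ n ∈ Icc (43 / 50 : ℝ) (22 / 25),
      ObsStiffnessSeqCeilingAt tp U n (4767609 / 10000000) := by
  intro tp htp U hU n hn
  refine ObsStiffnessSeqCeilingAt_on_box_of_bottomEdge_and_leftEdge_targetSlot (p := -49 / 100) (q := -47 / 100) (UA := 3)
    (Umax := Uhi) (n := n) (by norm_num) hUhi (by norm_num) (by linarith [hn.1]) (by linarith [hn.2])
    (fun _ _ => -(4767609 / 10000000 : ℝ)) (fun _ _ => -(4767609 / 10000000 : ℝ)) (4767609 / 10000000)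
    (fun σ hσ s hs ω Ls ψ hLs hψ h1 hω => ?_) (fun σ _ s _ => by norm_num) (fun σ hσ U' hU' ω Ls ψ hLs hψ h1 hω => ?_)
    (fun σ _ U' _ => by norm_num) tp htp U hU
  · rcases le_or_gt σ (-12 / 25) with hcut | hcut
    · exact hBo n hn σ ⟨hσ.1, hcut⟩ s hs ω Ls ψ hLs hψ h1 hω
    · exact hg1201M19P10_innerSlot_orbitMean_ge_negBar σ 3 s 3 ⟨hcut.le, hσ.2⟩ (by linarith [hn.1]) hn.2 ω Ls ψ hLs hψ h1 hω
  · rcases le_or_gt σ (-12 / 25) with hcut | hcut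
    · exact hLo n hn σ ⟨hσ.1, hcut⟩ U' hU' ω Ls ψ hLs hψ h1 hω
    · exact hg1201M19P10_innerSlot_orbitMean_ge_negBar σ U' (-49 / 100) U' ⟨hcut.le, hσ.2⟩ (by linarith [hn.1]) hn.2 ω Ls ψ hLs hψ h1 hω

/-- **@10 PREFIX SLICE CEILING AND THE `[3, 5]` READING BY NAME** (rational `U_hi ≥ 3`; part 13's `stiffnessBoxCeilingBelow_M19P10Ucell_of_cornerStrip`; at `U_hi = 5` part 13's
`hg1201E_P10cell35_rungs_of_ceiling` reads the Jang band `[51/25, 51/20]` at EVERY `t_eff` and the four cut members on `[m/5, 17/25]`; at `U_hi = 17/2` the @10 leaf by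
`Hg1201M19P10_StiffnessBoxCeiling_of_cornerStrip`). CONDITIONAL. [cite: ScalapinoWhiteZhang1993, §II] -/
theorem stiffnessBoxCeilingBelow_M19P10Prefix_of_outerEdgeWords {Uhi : ℚ} (hUhi : (3 : ℚ) ≤ Uhi)
    (hLo : ∀ n ∈ Set.Icc (43 / 50 : ℝ) (22 / 25), ∀ σ ∈ Set.Icc (-49 / 100 : ℝ) (-12 / 25), ∀ U' ∈ Set.Icc (3 : ℝ) (Uhi : ℝ),
      ∀ (ω : InfVolFermionState 2) (Ls : ℕ → ℕ) (ψ : ∀ L, Fock (Orb (FermionTorus 2 L))),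
      Tendsto Ls atTop atTop →
      (∀ j, IsGroundStateInSector (hubbardTorusTT' (Ls j) 1 (-49 / 100) U') (rectN n (Ls j)) 0 (ψ (Ls j))) →
      (∀ j, star (ψ (Ls j)) ⬝ᵥ ψ (Ls j) = 1) → ω.IsTorusLimitOf ψ Ls →
      -(4767609 / 10000000 : ℝ) ≤ ((Finset.univ : Finset (DihedralGroup 4)).card : ℝ)⁻¹ * ∑ g ∈ (Finset.univ : Finset (DihedralGroup 4)),
        (ω.expect (d4ShiftSet g 0 (Literature.Probability.LatticeModels.box 2 7))
          (fermionEmbed (PolySite.d4Emb g 0 (Literature.Probability.LatticeModels.box 2 7)) (-oddMomentObsTT σ U' 0))).re)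
    (hBo : ∀ n ∈ Set.Icc (43 / 50 : ℝ) (22 / 25), ∀ σ ∈ Set.Icc (-49 / 100 : ℝ) (-12 / 25), ∀ s ∈ Set.Icc (-49 / 100 : ℝ) σ,
      ∀ (ω : InfVolFermionState 2) (Ls : ℕ → ℕ) (ψ : ∀ L, Fock (Orb (FermionTorus 2 L))),
      Tendsto Ls atTop atTop →
      (∀ j, IsGroundStateInSector (hubbardTorusTT' (Ls j) 1 s 3) (rectN n (Ls j)) 0 (ψ (Ls j))) →
      (∀ j, star (ψ (Ls j)) ⬝ᵥ ψ (Ls j) = 1) → ω.IsTorusLimitOf ψ Ls →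
      -(4767609 / 10000000 : ℝ) ≤ ((Finset.univ : Finset (DihedralGroup 4)).card : ℝ)⁻¹ * ∑ g ∈ (Finset.univ : Finset (DihedralGroup 4)),
        (ω.expect (d4ShiftSet g 0 (Literature.Probability.LatticeModels.box 2 7))
          (fermionEmbed (PolySite.d4Emb g 0 (Literature.Probability.LatticeModels.box 2 7)) (-oddMomentObsTT σ 3 0))).re) :
    StiffnessBoxCeilingBelow (boxHg1201E_M19P10.withEntry .UOverT (Entry.ofEnds 3 Uhi hUhi .screening)) (4767609 / 10000000) ∧
    (Uhi = 17 / 2 → Hg1201M19P10_StiffnessBoxCeiling) := by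
  have hU' : (3 : ℝ) ≤ (Uhi : ℝ) := by exact_mod_cast hUhi
  have h := hg1201M19P10_prefixStrip_of_outerEdgeWords hU' hLo hBo
  refine ⟨stiffnessBoxCeilingBelow_M19P10Ucell_of_cornerStrip hUhi le_rfl fun tp htp U hU n hn => h tp htp U ⟨?_, hU.2⟩ n hn, fun he => ?_⟩
  · have h1 := hU.1
    push_cast at h1
    exact h1
  · subst he
    refine Hg1201M19P10_StiffnessBoxCeiling_of_cornerStrip le_rfl fun tp htp U hU n hn => h tp htp U ⟨hU.1, ?_⟩ n hn
    have h2 := hU.2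
    push_cast
    linarith

end Summit.Ventures.CertifiedManyBodySolver.Downfold

end
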